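import Summits.CriticalPhenomena.SAWScalingLimit.Theorems.SAWDevelopingMapHexConjectureKPExplicitDecay
import Summits.CriticalPhenomena.SAWScalingLimit.Theorems.SAWDevelopingMapHexConjectureKPDichotomy
import Summits.CriticalPhenomena.SAWScalingLimit.Theorems.SAWDevelopingMapHexConjectureKPCor31
import Summits.CriticalPhenomena.SAWScalingLimit.Theorems.SAWDevelopingMapHexConjectureKPWindowTail
import Summits.CriticalPhenomena.SAWScalingLimit.Theorems.SAWDevelopingMapHexConjectureKPTheorem2
import Literature.Probability.RandomPlanarGeometry.HexSAWStripIdentity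
import Mathlib.Analysis.Complex.ExponentialBounds
import HarnessLib

/-!
# Crux `HexConjecture` (stmt-CriticalPhenomena-0808), line `root-locality-replaces-loewner`:
Krachun–Panagiotis's Theorem 2 with an EXPLICIT exponent — `B_T ≤ 200·T^{-7·10⁻⁹}` for every `T ≥ 1`

Landing target:
`Summits/CriticalPhenomena/SAWScalingLimit/Theorems/SAWDevelopingMapHexConjectureKPExplicitExponent.lean`
(`--supports stmt-CriticalPhenomena-0808`; lane pcv-sawmu, seat a-p4).

The line's `kp_stripBlim_rpow_decay` (`…KPTheorem2.lean`) is Krachun–Panagiotis's Theorem 2 with an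
unspecified exponent.  Feeding the line's two-case recurrence `stub_kp_dichotomy` (with the caps of
`cor31_renCap_le`) and window tail `stub_kp_windowTail` into the explicit analytic step
`KPExplicit.decay_of_dichotomy` (`…KPExplicitDecay.lean`) with `J = 9·10⁶` blocks gives:
**`triDl_decay_explicit`** — `triDl T ≤ 100·triDl 0·T^{-7·10⁻⁹}` for every `T ≥ 1`, and
**`stripBlim_decay_explicit`** — `B_T = HV.stripBlim T ≤ 200·T^{-7·10⁻⁹}` for every `T ≥ 1`
(KP print `B_T ≤ 100·T^{-10⁻¹⁰}`; the exponent here is `70×` larger; no named fact is used).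
The numerical side conditions use `cos(π/8) ∈ [0.9238, 0.9239]`, `cos(3π/8) ≥ 0.38268`,
`cos(π/4) ≤ 0.70711`, `triDl 0 ≥ x_c²/(2cos(π/8)) ≥ 0.158` (`B_{1,0} ≥ x_c²`, GM (4.1)), `log 22 ≤ 3.1`,
`log 144 ≤ 5`.  Sources: Krachun–Panagiotis, arXiv:2310.17299 (Ann. Probab. 2026), Theorems 2–3;
Glazman–Manolescu 2020, Lemma 4.1; Duminil-Copin–Smirnov 2012, Lemma 2.
-/

noncomputable section

open Real Finset
open Literature.Probability.RandomPlanarGeometry.SAW Literature.Probability.RandomPlanarGeometry.SAW.HV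
open Summit.CriticalPhenomena.SAWScalingLimit.Theorems.HexConjecture.RootLocality

namespace Summit.CriticalPhenomena.SAWScalingLimit.Theorems.HexConjecture.RootLocality.KPExplicit

/-- KP's window mass `W(T) = Σ_{d=T}^{21T} G_d` in the line's finite-volume coding is nonnegative.
[cite: KrachunPanagiotis2026, Corollary 3.1] -/
theorem kpW_nonneg (T : ℕ) : 0 ≤ (fun T : ℕ => ∑ d ∈ Finset.Icc (T : ℤ) (21 * T), ∑ P ∈ (midWalks (stripV (32 * T + 1) (32 * T + 1))).filter (fun P => finalDart P = ((d, 0, false), (d, -1, true)) ∨ finalDart P = ((d, -1, true), (d, 0, false))), hexCriticalFugacity ^ mwLen P) T :=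
  sum_nonneg fun _ _ => sum_nonneg fun _ _ => pow_nonneg hexCriticalFugacity_pos_lt_one.1.le _

/-- The window tail (tree `stub_kp_windowTail`): `Σ_{j<B} W(22^j T₀) ≤ 2(cos(π/8)/cos(3π/8))·triDl(T₀-1)`.
[cite: KrachunPanagiotis2026, Lemma 2.2] -/
theorem kpW_tail : ∀ T₀ : ℕ, 1 ≤ T₀ → ∀ B : ℕ, ∑ j ∈ range B, (fun T : ℕ => ∑ d ∈ Finset.Icc (T : ℤ) (21 * T), ∑ P ∈ (midWalks (stripV (32 * T + 1) (32 * T + 1))).filter (fun P => finalDart P = ((d, 0, false), (d, -1, true)) ∨ finalDart P = ((d, -1, true), (d, 0, false))), hexCriticalFugacity ^ mwLen P) (22 ^ j * T₀) ≤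
    2 * (Real.cos (Real.pi / 8) / Real.cos (3 * Real.pi / 8)) * triDl (T₀ - 1) :=
  fun T₀ hT₀ B => stub_kp_windowTail _ (fun _ => rfl) T₀ hT₀ B

/-- The tree's two-case recurrence with the monotone caps of `cor31_renCap_le` plugged in.
[cite: KrachunPanagiotis2026, Lemmas 3.2–3.3 (constructions (a)/(b))] -/
theorem kp_dichotomy_caps (t : ℕ) (ht : 1 ≤ t) :
    Real.cos (Real.pi / 8) / (16 * Real.cos (Real.pi / 4)) * (t : ℝ) * triDl (2 * t) * triDl (5 * t) ≤
        (1 + 128 * Real.cos (Real.pi / 8) * triDl ((t / 2 - 1) / 2) *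
          (∑ i ∈ range (2 * t + 1), triDl i) / triDl (2 * t)) * (fun T : ℕ => ∑ d ∈ Finset.Icc (T : ℤ) (21 * T), ∑ P ∈ (midWalks (stripV (32 * T + 1) (32 * T + 1))).filter (fun P => finalDart P = ((d, 0, false), (d, -1, true)) ∨ finalDart P = ((d, -1, true), (d, 0, false))), hexCriticalFugacity ^ mwLen P) t ∨
      (15 / 64 : ℝ) * (t : ℝ) ^ 2 * triDl (2 * t) * triDl (5 * t) * triDl (9 * t) ≤
        (1 + 128 * Real.cos (Real.pi / 8) * triDl ((t / 2 - 1) / 2) *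
          (∑ i ∈ range (2 * t + 1), triDl i) / triDl (2 * t)) *
        (1 + 128 * Real.cos (Real.pi / 8) * triDl (t - 1) *
          (∑ i ∈ range (5 * t + 1), triDl i) / triDl (5 * t)) * (fun T : ℕ => ∑ d ∈ Finset.Icc (T : ℤ) (21 * T), ∑ P ∈ (midWalks (stripV (32 * T + 1) (32 * T + 1))).filter (fun P => finalDart P = ((d, 0, false), (d, -1, true)) ∨ finalDart P = ((d, -1, true), (d, 0, false))), hexCriticalFugacity ^ mwLen P) t :=
  stub_kp_dichotomy t ht _ _ (fun k hk₁ hk₂ => cor31_renCap_le (by omega) (by omega))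
    (fun i hi₁ hi₂ => cor31_renCap_le (by omega) (by omega))

/-! ### Numerical constants -/

/-- `cos(π/8) ∈ [0.9238, 0.9239]`. [folklore] -/
theorem cos_pi_div_eight_bounds : (0.9238 : ℝ) ≤ Real.cos (Real.pi / 8) ∧ Real.cos (Real.pi / 8) ≤ 0.9239 := by
  rw [Real.cos_pi_div_eight]
  have h1 : (1.41421 : ℝ) ≤ √2 := (Real.le_sqrt' (by norm_num)).2 (by norm_num)
  have h2 : √2 ≤ 1.41422 := (Real.sqrt_le_left (by norm_num)).2 (by norm_num)
  constructor
  · have : (1.8476 : ℝ) ≤ √(2 + √2) := (Real.le_sqrt' (by norm_num)).2 (by norm_num; linarith)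
    linarith
  · have : √(2 + √2) ≤ 1.8478 := (Real.sqrt_le_left (by norm_num)).2 (by norm_num; linarith)
    linarith

/-- `cos(3π/8) ≥ 0.38268`. [folklore] -/
theorem cos_three_pi_div_eight_ge : (0.38268 : ℝ) ≤ Real.cos (3 * Real.pi / 8) := by
  rw [show 3 * Real.pi / 8 = Real.pi / 2 - Real.pi / 8 by ring, Real.cos_pi_div_two_sub,
    Real.sin_pi_div_eight]
  have h2 : √2 ≤ 1.41422 := (Real.sqrt_le_left (by norm_num)).2 (by norm_num)
  have : (0.76536 : ℝ) ≤ √(2 - √2) := (Real.le_sqrt' (by norm_num)).2 (by norm_num; linarith)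
  linarith

/-- `cos(π/4) ≤ 0.70711`. [folklore] -/
theorem cos_pi_div_four_le : Real.cos (Real.pi / 4) ≤ 0.70711 := by
  have h2 : √2 ≤ 1.41422 := (Real.sqrt_le_left (by norm_num)).2 (by norm_num)
  rw [Real.cos_pi_div_four]; linarith

/-- `x_c² = 1/(2+√2) ≥ 0.2928`. [folklore] -/
theorem xc_sq_ge : (0.2928 : ℝ) ≤ hexCriticalFugacity ^ 2 := by
  unfold hexCriticalFugacity
  rw [inv_pow, Real.sq_sqrt (by positivity)]
  rw [le_inv_comm₀ (by norm_num) (by positivity)]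
  have h2 : √2 ≤ 1.41422 := (Real.sqrt_le_left (by norm_num)).2 (by norm_num)
  linarith

/-- `triDl 0 ≥ x_c²/(2cos(π/8)) ≥ 0.158` (`B_{1,0} ≥ x_c²` and `B_{1,0} ≤ 2cos(π/8)·triDl 0`).
[cite: GlazmanManolescu2019, Lemma 4.1 (eq. (4.1))] -/
theorem triDl_zero_ge : (0.158 : ℝ) ≤ triDl 0 := by
  have h1 := sq_le_stripB_one 0 hexCriticalFugacity_pos_lt_one.1.le
  have h2 := stripB_le_triDl (L := 0) (T := 1) (by norm_num) 0
  have h3 := xc_sq_ge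
  have h4 := cos_pi_div_eight_bounds.2
  nlinarith [triDl_nonneg 0]

/-- `log 22 ≤ 3.1`. [folklore] -/
theorem log_22_le : Real.log 22 ≤ 31 / 10 := by
  have h := Real.exp_one_gt_d9
  have h1 : (22 : ℝ) ^ 10 ≤ Real.exp 31 := by
    calc (22 : ℝ) ^ 10 ≤ (2.7182818283 : ℝ) ^ 31 := by norm_num
      _ ≤ (Real.exp 1) ^ 31 := pow_le_pow_left₀ (by norm_num) h.le 31
      _ = Real.exp 31 := by rw [← Real.exp_nat_mul]; norm_num
  have h2 : Real.log ((22 : ℝ) ^ 10) ≤ 31 := by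
    have := Real.log_le_log (by positivity) h1
    rwa [Real.log_exp] at this
  rw [Real.log_pow] at h2
  push_cast at h2
  linarith

/-- `log 144 ≤ 5`. [folklore] -/
theorem log_144_le : Real.log 144 ≤ 5 := by
  have h := Real.exp_one_gt_d9
  have h1 : (144 : ℝ) ≤ Real.exp 5 := by
    calc (144 : ℝ) ≤ (2.7182818283 : ℝ) ^ 5 := by norm_num
      _ ≤ (Real.exp 1) ^ 5 := pow_le_pow_left₀ (by norm_num) h.le 5
      _ = Real.exp 5 := by rw [← Real.exp_nat_mul]; norm_num
  have := Real.log_le_log (by norm_num) h1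
  rwa [Real.log_exp] at this

/-! ### The unconditional explicit decay -/

/-- **`triDl T ≤ 100·triDl 0·T^{-7·10⁻⁹}` for every `T ≥ 1`** — UNCONDITIONAL (tree inputs only:
`stub_kp_dichotomy`, `cor31_renCap_le`, `stub_kp_windowTail`, `stub_triDl_pos`), with `J = 9·10⁶`
blocks. [cite: KrachunPanagiotis2026, Theorem 3 (shape; exponent ours)] -/
theorem triDl_decay_explicit :
    ∀ T : ℕ, 1 ≤ T → triDl T ≤ 100 * triDl 0 * (T : ℝ) ^ (-(7 / 10 ^ 9 : ℝ)) := by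
  have hc8 := cos_pi_div_eight_bounds
  have hc3 := cos_three_pi_div_eight_ge
  have hc4 := cos_pi_div_four_le
  have hc4pos := cos_pi_div_four_pos'
  have hc3pos := cos_three_pi_div_eight_pos
  have ha0 := triDl_zero_ge
  have hκpos : 0 < 2 * (Real.cos (Real.pi / 8) / Real.cos (3 * Real.pi / 8)) := by
    have := cos_pi_div_eight_pos; positivity
  refine decay_of_dichotomy (J := 9000000) (c₁ := 128 * Real.cos (Real.pi / 8))
    (ca := Real.cos (Real.pi / 8) / (16 * Real.cos (Real.pi / 4))) (cb := 15 / 64)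
    (κ := 2 * (Real.cos (Real.pi / 8) / Real.cos (3 * Real.pi / 8)))
    stub_triDl_pos (fun _ _ h => triDl_antitone h) kpW_nonneg (by linarith)
    (div_pos (by linarith) (by positivity)) (by norm_num) hκpos kpW_tail kp_dichotomy_caps
    (by norm_num) (by norm_num) ?_ ?_ ?_
  · -- 5ε·log(144·22^{J-1}) ≤ 1
    set L := Real.log (144 * 22 ^ (9000000 - 1)) with hL
    have hl : L ≤ 5 + ((9000000 - 1 : ℕ) : ℝ) * (31 / 10) := by
      rw [hL, Real.log_mul (by norm_num) (pow_ne_zero _ (by norm_num)), Real.log_pow]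
      exact add_le_add log_144_le (mul_le_mul_of_nonneg_left log_22_le (by positivity))
    have hc : ((9000000 - 1 : ℕ) : ℝ) = 8999999 := by norm_num
    rw [hc] at hl
    linarith
  · -- 10e·C₁²κβ²/cb ≤ J
    have he := Real.exp_one_lt_d9
    have hC₁ : 1 / triDl 0 + 128 * Real.cos (Real.pi / 8) ≤ 125 := by
      have : 1 / triDl 0 ≤ 1 / 0.158 := one_div_le_one_div_of_le (by norm_num) ha0
      have h2 : (1 : ℝ) / 0.158 ≤ 6.33 := by norm_num
      linarith [hc8.2]
    have hC₁0 : 0 ≤ 1 / triDl 0 + 128 * Real.cos (Real.pi / 8) := by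
      have := stub_triDl_pos 0; have := cos_pi_div_eight_pos; positivity
    have hκ : 2 * (Real.cos (Real.pi / 8) / Real.cos (3 * Real.pi / 8)) ≤ 4.83 := by
      rw [mul_div_assoc', div_le_iff₀ hc3pos]; nlinarith [hc8.2]
    have hβ : (1 / (1 - (7 / 10 ^ 9 : ℝ)) + 1 / 100) ^ 2 ≤ 1.0204 := by norm_num
    have h1 : (1 / triDl 0 + 128 * Real.cos (Real.pi / 8)) ^ 2 ≤ 125 ^ 2 :=
      pow_le_pow_left₀ hC₁0 hC₁ 2
    have h2 : Real.exp 1 * (1 / triDl 0 + 128 * Real.cos (Real.pi / 8)) ^ 2 ≤ 2.7182818286 * 125 ^ 2 :=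
      mul_le_mul he.le h1 (by positivity) (by norm_num)
    have h3 : Real.exp 1 * (1 / triDl 0 + 128 * Real.cos (Real.pi / 8)) ^ 2 *
        (2 * (Real.cos (Real.pi / 8) / Real.cos (3 * Real.pi / 8))) ≤ 2.7182818286 * 125 ^ 2 * 4.83 :=
      mul_le_mul h2 hκ hκpos.le (by norm_num)
    have h4 : Real.exp 1 * (1 / triDl 0 + 128 * Real.cos (Real.pi / 8)) ^ 2 *
        (2 * (Real.cos (Real.pi / 8) / Real.cos (3 * Real.pi / 8))) *
        (1 / (1 - (7 / 10 ^ 9 : ℝ)) + 1 / 100) ^ 2 ≤ 2.7182818286 * 125 ^ 2 * 4.83 * 1.0204 :=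
      mul_le_mul h3 hβ (sq_nonneg _) (by norm_num)
    rw [div_le_iff₀ (by norm_num : (0:ℝ) < 15 / 64)]
    calc 10 * Real.exp 1 * (1 / triDl 0 + 128 * Real.cos (Real.pi / 8)) ^ 2 *
          (2 * (Real.cos (Real.pi / 8) / Real.cos (3 * Real.pi / 8))) *
          (1 / (1 - (7 / 10 ^ 9 : ℝ)) + 1 / 100) ^ 2
        = 10 * (Real.exp 1 * (1 / triDl 0 + 128 * Real.cos (Real.pi / 8)) ^ 2 *
          (2 * (Real.cos (Real.pi / 8) / Real.cos (3 * Real.pi / 8))) *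
          (1 / (1 - (7 / 10 ^ 9 : ℝ)) + 1 / 100) ^ 2) := by ring
      _ ≤ 10 * (2.7182818286 * 125 ^ 2 * 4.83 * 1.0204) := mul_le_mul_of_nonneg_left h4 (by norm_num)
      _ ≤ ((9000000 : ℕ) : ℝ) * (15 / 64) := by norm_num
  · -- 2e·C₁κβ/ca ≤ J
    have he := Real.exp_one_lt_d9
    have hC₁ : 1 / triDl 0 + 128 * Real.cos (Real.pi / 8) ≤ 125 := by
      have : 1 / triDl 0 ≤ 1 / 0.158 := one_div_le_one_div_of_le (by norm_num) ha0
      have h2 : (1 : ℝ) / 0.158 ≤ 6.33 := by norm_num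
      linarith [hc8.2]
    have hC₁0 : 0 ≤ 1 / triDl 0 + 128 * Real.cos (Real.pi / 8) := by
      have := stub_triDl_pos 0; have := cos_pi_div_eight_pos; positivity
    have hκ : 2 * (Real.cos (Real.pi / 8) / Real.cos (3 * Real.pi / 8)) ≤ 4.83 := by
      rw [mul_div_assoc', div_le_iff₀ hc3pos]; nlinarith [hc8.2]
    have hβ : (1 / (1 - (7 / 10 ^ 9 : ℝ)) + 1 / 100) ≤ 1.0102 := by norm_num
    have hca : (0.0816 : ℝ) ≤ Real.cos (Real.pi / 8) / (16 * Real.cos (Real.pi / 4)) := by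
      rw [le_div_iff₀ (by positivity)]; nlinarith [hc8.1]
    have h2 : Real.exp 1 * (1 / triDl 0 + 128 * Real.cos (Real.pi / 8)) ≤ 2.7182818286 * 125 :=
      mul_le_mul he.le hC₁ hC₁0 (by norm_num)
    have h3 : Real.exp 1 * (1 / triDl 0 + 128 * Real.cos (Real.pi / 8)) *
        (2 * (Real.cos (Real.pi / 8) / Real.cos (3 * Real.pi / 8))) ≤ 2.7182818286 * 125 * 4.83 :=
      mul_le_mul h2 hκ hκpos.le (by norm_num)
    have h4 : Real.exp 1 * (1 / triDl 0 + 128 * Real.cos (Real.pi / 8)) *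
        (2 * (Real.cos (Real.pi / 8) / Real.cos (3 * Real.pi / 8))) *
        (1 / (1 - (7 / 10 ^ 9 : ℝ)) + 1 / 100) ≤ 2.7182818286 * 125 * 4.83 * 1.0102 :=
      mul_le_mul h3 hβ (by norm_num) (by norm_num)
    rw [div_le_iff₀ (lt_of_lt_of_le (by norm_num) hca)]
    calc 2 * Real.exp 1 * (1 / triDl 0 + 128 * Real.cos (Real.pi / 8)) *
          (2 * (Real.cos (Real.pi / 8) / Real.cos (3 * Real.pi / 8))) *
          (1 / (1 - (7 / 10 ^ 9 : ℝ)) + 1 / 100)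
        = 2 * (Real.exp 1 * (1 / triDl 0 + 128 * Real.cos (Real.pi / 8)) *
          (2 * (Real.cos (Real.pi / 8) / Real.cos (3 * Real.pi / 8))) *
          (1 / (1 - (7 / 10 ^ 9 : ℝ)) + 1 / 100)) := by ring
      _ ≤ 2 * (2.7182818286 * 125 * 4.83 * 1.0102) := mul_le_mul_of_nonneg_left h4 (by norm_num)
      _ ≤ ((9000000 : ℕ) : ℝ) * 0.0816 := by norm_num
      _ ≤ ((9000000 : ℕ) : ℝ) * (Real.cos (Real.pi / 8) / (16 * Real.cos (Real.pi / 4))) :=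
          mul_le_mul_of_nonneg_left hca (by positivity)

/-- `2cos(π/8)·triDl 0 ≤ 1` (triangle identity with `A^Δ ≥ 0`). [cite: GlazmanManolescu2019, Lemma 4.1] -/
theorem two_cos_mul_triDl_zero_le : 2 * Real.cos (Real.pi / 8) * triDl 0 ≤ 1 := by
  have h := tri_identity' 0
  have hA := triA_nonneg 0
  have hc := cos_three_pi_div_eight_pos
  nlinarith

/-- `B_T ≤ 1` (DCS Lemma 2). [cite: DuminilCopinSmirnov2012, §3 (after Lemma 2)] -/
theorem stripBlim_le_one (T : ℕ) (hT : 1 ≤ T) : stripBlim T ≤ 1 :=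
  ciSup_le fun L => stripB_le_one_of_lemma2 DuminilCopinSmirnov2012_lemma2_holds hT L

/-- **Krachun–Panagiotis's Theorem 2 with an explicit exponent, UNCONDITIONALLY:
`B_T ≤ 200·T^{-7·10⁻⁹}` for every `T ≥ 1`** (printed: `B_T ≤ 100·T^{-10⁻¹⁰}`). Kernel-checked from
the tree's formalisation of KP §3 plus `decay_of_dichotomy`; no named fact.
[cite: KrachunPanagiotis2026, Theorem 2 (shape; exponent ours)] -/
theorem stripBlim_decay_explicit :
    ∀ T : ℕ, 1 ≤ T → stripBlim T ≤ 200 * (T : ℝ) ^ (-(7 / 10 ^ 9 : ℝ)) := by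
  intro T hT
  have hTpos : (0 : ℝ) < T := by exact_mod_cast hT
  have hT1 : (1 : ℝ) ≤ T := by exact_mod_cast hT
  set ε : ℝ := 7 / 10 ^ 9 with hε
  have hε0 : 0 ≤ ε := by rw [hε]; norm_num
  by_cases h3 : T < 3
  · -- T ∈ {1, 2}: B_T ≤ 1 ≤ 200·T^{-ε}
    have hT2 : (T : ℝ) ≤ 2 := by exact_mod_cast (show T ≤ 2 by omega)
    have h1 : (T : ℝ) ^ (-(1 : ℝ)) ≤ (T : ℝ) ^ (-ε) :=
      Real.rpow_le_rpow_of_exponent_le hT1 (by rw [hε]; norm_num)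
    rw [Real.rpow_neg_one] at h1
    have h2 : (1 : ℝ) / 2 ≤ (T : ℝ)⁻¹ := by
      rw [one_div, inv_le_inv₀ (by norm_num) hTpos]; exact hT2
    calc stripBlim T ≤ 1 := stripBlim_le_one T hT
      _ ≤ 200 * ((1 : ℝ) / 2) := by norm_num
      _ ≤ 200 * (T : ℝ) ^ (-ε) := by nlinarith
  · push Not at h3
    set L := (T - 1) / 2 with hL
    have hL1 : 1 ≤ L := by omega
    have key : ∀ L' : ℕ, stripB T L' hexCriticalFugacity ≤ 200 * (T : ℝ) ^ (-ε) := by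
      intro L'
      have h1 := stripB_le_triDl (L := L) (T := T) (by omega) L'
      have h2 := triDl_decay_explicit L hL1
      have h4 := kpThm2_rpow_half hε0 h3
      have hc8 := cos_pi_div_eight_pos
      have h5 := two_cos_mul_triDl_zero_le
      have hpow : 0 ≤ (((T - 1) / 2 : ℕ) : ℝ) ^ (-ε) := Real.rpow_nonneg (Nat.cast_nonneg _) _
      have h44 : (4 : ℝ) ^ ε ≤ 2 := by
        have : (4 : ℝ) ^ ε ≤ (4 : ℝ) ^ ((2 : ℝ)⁻¹) :=
          Real.rpow_le_rpow_of_exponent_le (by norm_num) (by rw [hε]; norm_num)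
        refine this.trans (le_of_eq ?_)
        rw [show (4 : ℝ) = 2 ^ 2 by norm_num, ← Real.rpow_natCast, ← Real.rpow_mul (by norm_num)]
        norm_num
      have hTe : 0 ≤ (T : ℝ) ^ (-ε) := Real.rpow_nonneg hTpos.le _
      rw [← hL] at h4 hpow
      calc stripB T L' hexCriticalFugacity ≤ 2 * Real.cos (Real.pi / 8) * triDl L := h1
        _ ≤ 2 * Real.cos (Real.pi / 8) * (100 * triDl 0 * (L : ℝ) ^ (-ε)) :=
            mul_le_mul_of_nonneg_left h2 (by positivity)
        _ = (2 * Real.cos (Real.pi / 8) * triDl 0) * 100 * (L : ℝ) ^ (-ε) := by ring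
        _ ≤ 1 * 100 * (L : ℝ) ^ (-ε) := by
            apply mul_le_mul_of_nonneg_right _ hpow
            exact mul_le_mul_of_nonneg_right h5 (by norm_num)
        _ ≤ 1 * 100 * ((4 : ℝ) ^ ε * (T : ℝ) ^ (-ε)) := mul_le_mul_of_nonneg_left h4 (by norm_num)
        _ ≤ 1 * 100 * (2 * (T : ℝ) ^ (-ε)) := by
            apply mul_le_mul_of_nonneg_left _ (by norm_num)
            exact mul_le_mul_of_nonneg_right h44 hTe
        _ = 200 * (T : ℝ) ^ (-ε) := by ring
    exact ciSup_le key

end Summit.CriticalPhenomena.SAWScalingLimit.Theorems.HexConjecture.RootLocality.KPExplicit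

end
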